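import Mathlib
import Literature.MathematicalPhysics.QuantumFieldTheory.Balaban1983to89.B12Average012Prop2
import Literature.MathematicalPhysics.QuantumFieldTheory.Balaban1983to89.B12Average012Periodicity

/-!
# `Balaban1983to89.B12Average012Permutation` — [Balaban1987RG1] (2.17) «(rU)(b) = U(rb)» for the PERMUTATIONS OF
# THE AXES: the averaged contour variables (0.11), the average (0.12) and its `k`-fold iterate of the b12 lineage
# (the cell's rendering of [I]'s ACTUAL average on `ℤᵈ`) are COVARIANT under every permutation `σ` of the
# coordinate axes — `𝐔_{rU}(q,x) = 𝐔_U(rq,rx)`, `\overline{rU} = rŪ`, `\overline{rU}^k = rŪ^k` — on the regular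
# (small-field) configurations where the average lives

HONEST FRAMING (cell `lit-balaban`, verbatim): statement-level skeleton of published theorems with citation tags;
proofs where landed; nothing here is a claim about the Yang–Mills mass gap.

CITATION HEADER.  T. Bałaban, *Renormalization group approach to lattice gauge field theories. I*, Commun. Math.
Phys. **109** (1987) 249–301, doi:10.1007/bf01215223 [Balaban1987RG1] (cell paper B12 = «[I]»).  PDF held:
`paper:balaban1987-cmp109-rg-i-small-field` (journal page = PDF page + 248); pp. 252–254 [PDF 4–6] ((0.4)–(0.12)),
p. 263 [PDF 15], p. 269 [PDF 21] ((2.17)) re-read this generation from the held text layer.  [12] = [B7] =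
[Balaban1985Averaging], Commun. Math. Phys. **98** (1985) 17–51, (9) p. 18 and (10)–(11) p. 19 (covariance of
averages; p. 19 carries (10)–(13), p. 18 ends with (9) — CITELOC row P39-006 of `pub-balaban` summit-lit1 gen 39,
read on the page image `cmp_png/B7/p003.png`; v1.0/v1.1 printed «(10)–(11) p. 18»).  Unit
`lit-balaban-r09` gen 12 (display owner of CMP 109; TAKING line `HOME/STATUS.md` 2026-08-22T00:27Z; gen-9 MENU
item (4)), HOME `run/shared/lean/pub/lit-balaban/`; SKELETON rows `B12.Eq0.11`, `B12.Eq0.12`, `B12.Eq2.17-2.18`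
and `B12.Eq0.16`/`B12.Eq2.1` (cells only; no head change).  Companion files of the same lineage: `B12Average012Periodicity` (translations),
`B12Average012Covariance`/`…CovarianceIter` (gauge transformations).

WHAT IS PRINTED (verbatim; v1.2 re-read on the page images `pub-balaban/b2b-balaban-ref1/pages/1987-cmp109-…/
p004-x2.png`, `p015-x2.png`, `p021-x2.png` — v1.0/v1.1 carried PARAPHRASES inside the guillemets at p. 252 and
p. 263 (referee ref-1 gen 49 F4-NIT ×2) and two transcription slips at p. 269, all corrected here; no declaration
touched).  p. 252: *«For a point x ∈ B(y) we take a family 𝐆(y, x) of shortest contours with the initial point at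
y, and the final point at x. If x − y = Σ_{μ=1}^{d} δn_μe_μ (δ is a lattice spacing, n_μ an integer such that
|n_μ| ≦ L − 1/2), then we construct contours of 𝐆(y, x) in the following way: take a permutation {π(1), π(2), …} of
indices μ with nonzero numbers n_μ, next take |n_{π(1)}| bonds in the direction sign n_{π(1)}e_{π(1)} starting at y,
|n_{π(2)}| bonds in the direction sign n_{π(2)}e_{π(2)} starting at y + δn_{π(1)}e_{π(1)}, and so on. We define
𝐆(y, x) as the family of contours generated by all such permuations [sic].»*  (Outside the quotation: «L − 1/2» is
print's typography for (L − 1)/2; «permuations» is printed so.)  p. 253, (0.7): *«M(π{𝐔_j}) = M({𝐔_j}) for an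
arbitrary permutation π of the set {𝐔_j}»*; (0.11) *«𝐔(y, x) = M({U(Γ)}_{Γ ∈ 𝐆(y,x)})»*.  p. 254: *«This average has
properties similar to the properties of the average introduced in (0.4), especially all results of the paper [12]
are valid for it.»*  p. 263: *«Other symmetries are Euclidean lattice transformations. We assume that the action
(1.3) is invariant with respect to the transformations of the lattice T^{(k)}. More precisely, we notice that the
explicitly defined expressions in the j-th term in (1.3) are invariant with respect to the Euclidean transformations
of the lattice T^{(j+1)}, and we assume that this is true for all expressions in this term.»*  p. 269, (2.17): *«Now
consider a Euclidean symmetry r of the torus T, preserving the torus T^{(k+1)}. We define generally (rU)(b) = U(rb),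
rb = r⟨b₋, b₊⟩ = ⟨rb₋, rb₊⟩. (2.17) By their definitions the expressions in (2.1) are invariant with respect to
these transformations.»*  (v1.0/v1.1 wrote «the torus T_η» and round brackets «r(b₋, b₊) = (rb₋, rb₊)» in this last
quotation; print has «the torus T,» and angle brackets.)

DICTIONARY print → Lean.  An axis permutation `σ : Equiv.Perm (Fin d)` acts on sites by `permSite σ x = x ∘ σ⁻¹`
(so `permSite σ e_μ = e_{σμ}`), on positively oriented bonds by `⟨x, x + e_μ⟩ ↦ ⟨σx, σx + e_{σμ}⟩`, and on bond
configurations by pull-back `permE σ U (x, μ) = U (permSite σ x, σ μ)` — print's `(rU)(b) = U(rb)` for `r` the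
lattice symmetry `x ↦ σx` (it preserves every lattice `L^jℤᵈ` and the orientation of bonds); on lattice words
(`B7Prop1Explicit.Letter`) the action relabels the axis of each letter (`permLetter`).  (0.11) `𝐔(q,x)` ↦
`B12ContourAverage253.Tavg`; (0.12) `Ū` ↦ `B12SmallFieldRegion255.avgBar`; `Ū^k` ↦ `B12Average012Prop2.avgIter012`;
[12] (52)'s `sup_p ‖U(∂p) − 1‖` ↦ `B12Average012Prop2.pdevZ`.

THE ARGUMENT FORMALISED.  § 1–§ 2: the action on sites, letters, words and configurations; parallel transports are
covariant, `(rV)(Γ based at x) = V(rΓ based at rx)` (`hol_permCfg`); the straight segments and the words `tw` of the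
[B8] word calculus are relabelled (`map_seg`, `map_tw`).  § 3: THE CONTOUR FAMILY `𝐆(q, x)` IS PERMUTATION
SYMMETRIC AS A SET — the contour labelled `π` is carried to the contour labelled `σπ` of `𝐆(rq, rx)`
(`map_permWord`, `permT_permE`); the corner cubes are carried to corner cubes (`permSite_blockMap`,
`permSite_blockBase`, `sum_blockSites_permSite`).  § 4: Federbush's mean (0.10) of the lineage is BASED at the tree
contour `π = 1`, and the relabelling moves the base to `σ`; by (0.7) — base-point independence on families of small
relative diameter, the tree's `B12ContourAverage253.fedAvg_comp_equiv` + `Tavg_eq_fedAvg` — the two means agree on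
`ε₀`-regular `U1`-valued configurations with `2(dL)²ε₀ ≤ 1/100` (`Tavg_permE`).  § 5: the straight transporters,
the (0.12) loops and the block sum are covariant (`lineR_permE`, `Ustr_permE`, `loopW_Tavg_permE`), whence
`\overline{rU} = rŪ` (`avgBar_permE`); plaquette variables and the regularity functional are covariant/invariant
(`plaquetteHolonomyZd_permE`, `pdevZ_permE`).  § 6: by induction through the levels, with regularity and
`U1`-membership at every level as hypotheses (`avgIter012_permE`), or from [12] Prop. 2 for unitary configurations
with `sup_p‖U(∂p) − 1‖ < α₀L^{−2k}` (`avgIter012_permE_of_unitary`, via `B12Average012Prop2.prop2_012`).  § 7: the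
p. 255 small field region attached to `V` (`B12SmallFieldRegion255.smallFieldRegion`) is carried onto the region
attached to `r_σV` (`permE_mem_smallFieldRegion`, `…_iff`) — print's «the expressions in (2.1) are invariant».
§ 8 (v1.1): print's `r` is a symmetry of the TORUS `T` — periods in the coordinate directions are carried to periods
with the direction relabelled (`shiftE_permE`, `permE_periodic`), `r_σ` descends to the discrete torus `(ℤ/N)ᵈ`
(`proj_permSite`, `permSite_torusLift`), and for `L^kN`-periodic configurations the covariance of the `k`-fold
average DESCENDS TO `T^{(k)}`: `(\overline{r_σU}^k)^♭(w, μ) = (Ū^k)^♭(r_σw, σμ)` at every torus site `w`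
(`avgIter012_permE_descend`, `avgIter012_permE_descend_of_unitary`; the descent `♭` is the tree's
`B7AvgPeriodicity.descend`, computed by `B12Average012Periodicity.avgIter012_descend`).

WHAT IS PROVED (kernel-checked, no `sorry`, axioms standard; object definitions `permSite`, `permSiteEquiv`,
`permLetter`, `permCfg`, `permE` (the action), NO `Prop` placeholder, net new unproved facts 0): see the theorem list
in the sections below; headline theorems **`Tavg_permE`**, **`avgBar_permE`**, **`pdevZ_permE`**,
**`avgIter012_permE`**, **`avgIter012_permE_of_unitary`**, **`permE_mem_smallFieldRegion_iff`**; v1.1 (same seat,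
APPEND-ONLY + one import; v1.0 = p311699): § 8 **`avgIter012_permE_descend`**, **`avgIter012_permE_descend_of_unitary`**.
v1.2 (unit `lit-balaban-r09` gen 13; v1.1 = p312388): DOCSTRING-ONLY — the p. 252 / p. 263 / p. 269 quotations of this
header re-transcribed verbatim from the page images (referee ref-1 gen 49 F4-NIT ×2: v1.1 paraphrased inside « »),
the [12] locator «(11) p. 18» → «(11) p. 19» here and at `avgBar_permE` (CITELOC P39-006), and the p. 263 phrase in
`avgBar_permE`'s docstring quoted as printed; no declaration, statement or proof changed.

DIVERGENCES FROM PRINT / WHAT IS NOT PROVED (honest scope).  (a) PERMUTATIONS ONLY.  The REFLECTIONS of the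
hyperoctahedral group are NOT a symmetry of the lineage's average: its contour family `𝐆(q, x)` is based at the
CORNER `q = L⌊x/L⌋` of the corner cube of `x` (`B12ContourAverage253` DIVERGENCE (a)), and a reflection carries corner
cubes to corner cubes based at the OPPOSITE corner; print's family is based at the cube CENTRE and is symmetric
under the full group.  Translations: `B12Average012Periodicity`; gauge transformations: `B12Average012Covariance`.
(b) The covariance of (0.11)/(0.12) is proved on the REGULAR domain only (`U1`-valued configurations with
`ε₀`-regular plaquettes, `2(dL)²ε₀ ≤ 1/100` — print's small-field region is far inside): the lineage's Federbush
mean (0.10) is extended TOTALLY off its domain by the value at the base contour `π = 1`, and that extension is not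
permutation symmetric; the parallel-transport, plaquette and straight-line statements (§ 1–§ 3, § 5 `lineR_permE`,
`Ustr_permE`, `plaquetteHolonomyZd_permE`, `pdevZ_permE`) are unconditional.  (c) `ℤᵈ` corner-cube geometry of the
lineage; the torus statement (§ 8, v1.1) is the descent of the `ℤᵈ` one through
`B12Average012Periodicity.avgIter012_descend` for `L^kN`-periodic configurations (uniform period `N` in every
direction, as the tree's descent; print's `L_μ` may depend on `μ` — then only the permutations preserving
`(L_μ)` are symmetries of `T`, not modelled).  (d) Nothing analytic is claimed.
-/

noncomputable section

open NormedSpace Finset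

namespace Literature.MathematicalPhysics.QuantumFieldTheory.Balaban1983to89.B12Average012Permutation

open Literature.MathematicalPhysics.QuantumLattice (ZdEdge blockMap blockBase blockSites mem_blockSites_iff
  plaquetteHolonomyZd)
open B7Prop1Explicit (Letter e seg hol hol_nil hol_cons stepHol disp disp_nil disp_cons U1 mem_U1
  norm_inv_sub_one_le)
open B8Lemma1NonAbelian (tw tw_nil tw_cons)
open B8Ineq170 (norm_mul_sub_one_le_of_norm_le_one)
open B7Eq61Linearization (lineR)
open B12HOperator267 (gammaT)
open B12AverageCorridor267 (Ustr loopW loopW_def avgM)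
open B12ContourAverage253 (permWord permT permT_one permT_mem_U1 rel rel_permT_small Tavg fedAvg
  fedAvg_comp_equiv Tavg_eq_fedAvg)
open B12SmallFieldRegion255 (avgBar)
open B12Average012Prop2 (pdevZ le_pdevZ avgIter012 avgIter012_zero avgIter012_succ prop2_012 C0A C0A_pos)
open B7Prop2Explicit (unitaryUnits unitaryUnits_le_U1 c2')

variable {d : ℕ}

/-! ## § 1  The action of an axis permutation on sites, letters, words and bond configurations -/

section Action

/-- [cite: Balaban1987RG1, (2.17) p.269] the lattice symmetry `r = r_σ` of `ℤᵈ` induced by a permutation `σ` of the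
coordinate axes: `(r_σ x)_{σμ} = x_μ`, i.e. `r_σ x = x ∘ σ⁻¹` (so that `r_σ e_μ = e_{σμ}`). -/
def permSite (σ : Equiv.Perm (Fin d)) (x : Fin d → ℤ) : Fin d → ℤ := fun ν => x (σ.symm ν)

/-- [cite: Balaban1987RG1, (2.17) p.269] unfolding of `r_σ` (elementary API). -/
@[simp] theorem permSite_apply (σ : Equiv.Perm (Fin d)) (x : Fin d → ℤ) (ν : Fin d) :
    permSite σ x ν = x (σ.symm ν) := rfl

/-- [cite: Balaban1987RG1, (2.17) p.269] `(r_σ x)_{σμ} = x_μ` (elementary API). -/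
@[simp] theorem permSite_apply_perm (σ : Equiv.Perm (Fin d)) (x : Fin d → ℤ) (μ : Fin d) :
    permSite σ x (σ μ) = x μ := by
  simp [permSite]

/-- [cite: Balaban1987RG1, (2.17) p.269] `r_1 = id` (elementary API). -/
@[simp] theorem permSite_one (x : Fin d → ℤ) : permSite 1 x = x := rfl

/-- [cite: Balaban1987RG1, (2.17) p.269] `r_{στ} = r_σ ∘ r_τ` (elementary API). -/
theorem permSite_mul (σ τ : Equiv.Perm (Fin d)) (x : Fin d → ℤ) :
    permSite (σ * τ) x = permSite σ (permSite τ x) := by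
  funext ν
  simp [permSite, Equiv.Perm.mul_def]

/-- [cite: Balaban1987RG1, (2.17) p.269] `r_{σ⁻¹} ∘ r_σ = id` (elementary API). -/
@[simp] theorem permSite_inv_permSite (σ : Equiv.Perm (Fin d)) (x : Fin d → ℤ) :
    permSite σ⁻¹ (permSite σ x) = x := by
  rw [← permSite_mul, inv_mul_cancel, permSite_one]

/-- [cite: Balaban1987RG1, (2.17) p.269] `r_σ ∘ r_{σ⁻¹} = id` (elementary API). -/
@[simp] theorem permSite_permSite_inv (σ : Equiv.Perm (Fin d)) (x : Fin d → ℤ) :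
    permSite σ (permSite σ⁻¹ x) = x := by
  rw [← permSite_mul, mul_inv_cancel, permSite_one]

/-- [cite: Balaban1987RG1, (2.17) p.269] `r_σ` as a bijection of `ℤᵈ` (elementary API). -/
def permSiteEquiv (σ : Equiv.Perm (Fin d)) : (Fin d → ℤ) ≃ (Fin d → ℤ) where
  toFun := permSite σ
  invFun := permSite σ⁻¹
  left_inv := permSite_inv_permSite σ
  right_inv := permSite_permSite_inv σ

/-- [cite: Balaban1987RG1, (2.17) p.269] unfolding (elementary API). -/
@[simp] theorem permSiteEquiv_apply (σ : Equiv.Perm (Fin d)) (x : Fin d → ℤ) : permSiteEquiv σ x = permSite σ x :=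
  rfl

/-- [cite: Balaban1987RG1, (2.17) p.269] `r_σ` is injective (elementary API). -/
theorem permSite_injective (σ : Equiv.Perm (Fin d)) : Function.Injective (permSite (d := d) σ) :=
  (permSiteEquiv σ).injective

/-- [cite: Balaban1987RG1, (2.17) p.269] `r_σ` is additive (elementary API). -/
@[simp] theorem permSite_add (σ : Equiv.Perm (Fin d)) (x y : Fin d → ℤ) :
    permSite σ (x + y) = permSite σ x + permSite σ y := rfl

/-- [cite: Balaban1987RG1, (2.17) p.269] `r_σ` commutes with subtraction (elementary API). -/
@[simp] theorem permSite_sub (σ : Equiv.Perm (Fin d)) (x y : Fin d → ℤ) :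
    permSite σ (x - y) = permSite σ x - permSite σ y := rfl

/-- [cite: Balaban1987RG1, (2.17) p.269] `r_σ` commutes with negation (elementary API). -/
@[simp] theorem permSite_neg (σ : Equiv.Perm (Fin d)) (x : Fin d → ℤ) : permSite σ (-x) = -permSite σ x := rfl

/-- [cite: Balaban1987RG1, (2.17) p.269] `r_σ 0 = 0` (elementary API). -/
@[simp] theorem permSite_zero (σ : Equiv.Perm (Fin d)) : permSite σ (0 : Fin d → ℤ) = 0 := rfl

/-- [cite: Balaban1987RG1, (2.17) p.269] `r_σ` is `ℤ`-linear (elementary API). -/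
@[simp] theorem permSite_smul (σ : Equiv.Perm (Fin d)) (z : ℤ) (x : Fin d → ℤ) :
    permSite σ (z • x) = z • permSite σ x := rfl

/-- [cite: Balaban1987RG1, (2.17) p.269] `r_σ (c·e_μ) = c·e_{σμ}` (elementary API). -/
@[simp] theorem permSite_single (σ : Equiv.Perm (Fin d)) (μ : Fin d) (c : ℤ) :
    permSite σ (Pi.single μ c) = Pi.single (σ μ) c := by
  funext ν
  simp only [permSite_apply, Pi.single_apply, Equiv.symm_apply_eq]

/-- [cite: Balaban1987RG1, (2.17) p.269] `r_σ e_μ = e_{σμ}` (elementary API). -/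
@[simp] theorem permSite_e (σ : Equiv.Perm (Fin d)) (μ : Fin d) : permSite σ (e μ) = e (σ μ) :=
  permSite_single σ μ 1

/-- [cite: Balaban1987RG1, p.252] the action on the letters of a lattice word: the axis is relabelled, the
orientation kept (elementary API). -/
def permLetter (σ : Equiv.Perm (Fin d)) (l : Letter d) : Letter d := (σ l.1, l.2)

/-- [cite: Balaban1987RG1, p.252] unfolding (elementary API). -/
@[simp] theorem permLetter_mk (σ : Equiv.Perm (Fin d)) (μ : Fin d) (b : Bool) :
    permLetter σ ((μ, b) : Letter d) = (σ μ, b) := rfl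

/-- [cite: Balaban1987RG1, p.252] the displacement of a relabelled letter is the image displacement (elementary
API). -/
@[simp] theorem vec_permLetter (σ : Equiv.Perm (Fin d)) (l : Letter d) :
    (permLetter σ l).vec = permSite σ l.vec := by
  obtain ⟨μ, b⟩ := l
  cases b <;> simp [Letter.vec, permLetter]

/-- [cite: Balaban1987RG1, p.252] the net displacement of a relabelled word is the image displacement (elementary
API). -/
theorem disp_map_permLetter (σ : Equiv.Perm (Fin d)) :
    ∀ w : List (Letter d), disp (w.map (permLetter σ)) = permSite σ (disp w)
  | [] => by simp
  | l :: w => by rw [List.map_cons, disp_cons, disp_cons, disp_map_permLetter σ w, vec_permLetter, permSite_add]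

variable {β : Type*}

/-- [cite: Balaban1987RG1, (2.17) p.269] **`(rU)(b) = U(rb)`** for `r = r_σ`: the pull-back of a bond configuration
of `ℤᵈ` by an axis permutation — the bond `⟨x, x + e_μ⟩` is read at `⟨r_σx, r_σx + e_{σμ}⟩` (orientation is
preserved by permutations). -/
def permE (σ : Equiv.Perm (Fin d)) (U : ZdEdge d → β) : ZdEdge d → β := fun b => U (permSite σ b.1, σ b.2)

/-- [cite: Balaban1987RG1, (2.17) p.269] unfolding (elementary API). -/
@[simp] theorem permE_apply (σ : Equiv.Perm (Fin d)) (U : ZdEdge d → β) (b : ZdEdge d) :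
    permE σ U b = U (permSite σ b.1, σ b.2) := rfl

/-- [cite: Balaban1987RG1, (2.17) p.269] `r_1 U = U` (elementary API). -/
@[simp] theorem permE_one (U : ZdEdge d → β) : permE 1 U = U := by
  funext b; simp

/-- [cite: Balaban1987RG1, (2.17) p.269] `r_{στ}U = r_τ(r_σ U)` — pull-backs compose contravariantly (elementary
API). -/
theorem permE_mul (σ τ : Equiv.Perm (Fin d)) (U : ZdEdge d → β) : permE (σ * τ) U = permE τ (permE σ U) := by
  funext b
  simp [permSite_mul, Equiv.Perm.mul_apply]

/-- [cite: Balaban1987RG1, (2.17) p.269] the same action on curried (site, direction) configurations, the format of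
the tree's word calculus `B7Prop1Explicit.hol` (elementary API). -/
def permCfg (σ : Equiv.Perm (Fin d)) (V : (Fin d → ℤ) → Fin d → β) : (Fin d → ℤ) → Fin d → β :=
  fun x μ => V (permSite σ x) (σ μ)

/-- [cite: Balaban1987RG1, (2.17) p.269] unfolding (elementary API). -/
@[simp] theorem permCfg_apply (σ : Equiv.Perm (Fin d)) (V : (Fin d → ℤ) → Fin d → β) (x : Fin d → ℤ) (μ : Fin d) :
    permCfg σ V x μ = V (permSite σ x) (σ μ) := rfl

/-- [cite: Balaban1987RG1, (2.17) p.269] currying intertwines the two formats (elementary API). -/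
theorem curry_permE (σ : Equiv.Perm (Fin d)) (U : ZdEdge d → β) :
    Function.curry (permE σ U) = permCfg σ (Function.curry U) := rfl

end Action

/-! ## § 2  Parallel transports, segments and words under the relabelling of the axes -/

section Words

variable {G : Type*} [Group G]

/-- [cite: Balaban1985Averaging, (9) p.18] one step of a word: `(r_σV)` read along the letter `l` from `x` is `V`
read along the relabelled letter from `r_σ x` (elementary API). -/
theorem stepHol_permCfg (σ : Equiv.Perm (Fin d)) (V : (Fin d → ℤ) → Fin d → G) (x : Fin d → ℤ) (l : Letter d) :
    stepHol (permCfg σ V) x l = stepHol V (permSite σ x) (permLetter σ l) := by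
  obtain ⟨μ, b⟩ := l
  cases b <;> simp [stepHol, Letter.vec, permLetter]

/-- [cite: Balaban1987RG1, (2.17) p.269][cite: Balaban1985Averaging, (9) p.18] **PARALLEL TRANSPORTS ARE
COVARIANT UNDER AXIS PERMUTATIONS**: `(r_σV)(Γ spelled from x) = V(r_σΓ spelled from r_σx)`, the word `r_σΓ`
relabelling every letter's axis by `σ`. -/
theorem hol_permCfg (σ : Equiv.Perm (Fin d)) (V : (Fin d → ℤ) → Fin d → G) :
    ∀ (x : Fin d → ℤ) (w : List (Letter d)), hol (permCfg σ V) x w = hol V (permSite σ x) (w.map (permLetter σ))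
  | x, [] => by simp
  | x, l :: w => by
    rw [List.map_cons, hol_cons, hol_cons, stepHol_permCfg, hol_permCfg σ V (x + l.vec) w, vec_permLetter,
      permSite_add]

/-- [cite: Balaban1985Averaging, p.20] the straight segment of `n` steps in direction `κ` is relabelled to the
straight segment in direction `σκ` (elementary API). -/
theorem map_seg (σ : Equiv.Perm (Fin d)) (κ : Fin d) : ∀ n : ℤ, (seg κ n).map (permLetter σ) = seg (σ κ) n
  | Int.ofNat n => by simp [seg, List.map_replicate]
  | Int.negSucc n => by simp [seg, List.map_replicate]

/-- [cite: Balaban1987RG1, p.252] the broken line walking the coordinates of `v` along the axes `ks` (in that order)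
is relabelled to the broken line walking the coordinates of `r_σ v` along the axes `σ(ks)` (elementary API). -/
theorem map_tw (σ : Equiv.Perm (Fin d)) (v : Fin d → ℤ) :
    ∀ ks : List (Fin d), (tw ks v).map (permLetter σ) = tw (ks.map σ) (permSite σ v)
  | [] => by simp
  | κ :: ks => by
    rw [tw_cons, List.map_append, map_seg, map_tw σ v ks, List.map_cons, tw_cons, permSite_apply_perm]

/-- [cite: Balaban1987RG1, p.252] **THE CONTOUR FAMILY `𝐆(q, x)` IS PERMUTATION SYMMETRIC AS A SET**: the contour
of `𝐆(q, q + v)` labelled by the axis order `π` is relabelled by `σ` to the contour of `𝐆(r_σq, r_σq + r_σv)` labelled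
by the axis order `σπ` («take a permutation {π(1), π(2), …} of indices μ …»). -/
theorem map_permWord (σ π : Equiv.Perm (Fin d)) (v : Fin d → ℤ) :
    (permWord π v).map (permLetter σ) = permWord (σ * π) (permSite σ v) := by
  unfold permWord
  rw [map_tw, List.map_map, ← Equiv.Perm.coe_mul]

end Words

/-! ## § 3  Corner cubes and the contour transporters `U(Γ^π_{q,x})` under the relabelling of the axes -/

section Blocks

variable {L : ℕ}

/-- [cite: Balaban1987RG1, (0.3) p.252] the block map commutes with axis permutations: `⌊r_σx/L⌋ = r_σ⌊x/L⌋`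
(coordinatewise floor) (elementary API). -/
theorem permSite_blockMap (σ : Equiv.Perm (Fin d)) (x : Fin d → ℤ) :
    permSite σ (blockMap L x) = blockMap L (permSite σ x) := rfl

/-- [cite: Balaban1987RG1, (0.3) p.252] corner cubes go to corner cubes: `r_σ(L·y) = L·(r_σ y)` (elementary API). -/
theorem permSite_blockBase (σ : Equiv.Perm (Fin d)) (y : Fin d → ℤ) :
    permSite σ (blockBase L y) = blockBase L (permSite σ y) := rfl

/-- [cite: Balaban1987RG1, (0.3) p.252] `x ∈ B(y) ↔ r_σ x ∈ B(r_σ y)` (elementary API). -/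
theorem permSite_mem_blockSites_iff (hL : 0 < L) (σ : Equiv.Perm (Fin d)) (y x : Fin d → ℤ) :
    permSite σ x ∈ blockSites L (permSite σ y) ↔ x ∈ blockSites L y := by
  haveI : NeZero L := ⟨hL.ne'⟩
  rw [mem_blockSites_iff, mem_blockSites_iff, ← permSite_blockMap]
  exact (permSite_injective σ).eq_iff

/-- [cite: Balaban1987RG1, (0.12) p.254] `B(r_σ y) = r_σ B(y)`: block sums are re-indexed by `r_σ` (elementary
API). -/
theorem sum_blockSites_permSite {M : Type*} [AddCommMonoid M] (hL : 0 < L) (σ : Equiv.Perm (Fin d))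
    (y : Fin d → ℤ) (f : (Fin d → ℤ) → M) :
    ∑ x ∈ blockSites L (permSite σ y), f x = ∑ x ∈ blockSites L y, f (permSite σ x) := by
  refine (Finset.sum_equiv (permSiteEquiv σ) (fun x => ?_) (fun x _ => rfl)).symm
  rw [permSiteEquiv_apply, permSite_mem_blockSites_iff hL]

variable {G : Type*} [Group G]

/-- [cite: Balaban1987RG1, p.252][cite: Balaban1987RG1, (2.17) p.269] **THE CONTOUR TRANSPORTERS OF `𝐆(q, x)` ARE
PERMUTATION COVARIANT**: `(r_σU)(Γ^π_{q,x}) = U(Γ^{σπ}_{r_σq, r_σx})` — the corner cube of `x` is carried onto the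
corner cube of `r_σx`, base corner to base corner, and the contour labelled `π` onto the contour labelled `σπ`. -/
theorem permT_permE (σ : Equiv.Perm (Fin d)) (U : ZdEdge d → G) (π : Equiv.Perm (Fin d)) (x : Fin d → ℤ) :
    permT L (permE σ U) π x = permT L U (σ * π) (permSite σ x) := by
  unfold permT
  rw [curry_permE, hol_permCfg, map_permWord, permSite_sub, permSite_blockBase, permSite_blockMap]

/-- [cite: Balaban1987RG1, (2.17) p.269] straight transporters: `(r_σU)([x, x + l e_μ]) = U([r_σx, r_σx + l e_{σμ}])`
(elementary API). -/
theorem lineR_permE (σ : Equiv.Perm (Fin d)) (R : ZdEdge d → G) (x : Fin d → ℤ) (μ : Fin d) (l : ℕ) :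
    lineR (permE σ R) x μ l = lineR R (permSite σ x) (σ μ) l := by
  unfold lineR
  congr 1
  funext t
  simp only [permE_apply, permSite_add, permSite_single]

/-- [cite: Balaban1987RG1, (0.12) p.254] `(r_σU)(c) = U(r_σc)` for the coarse bond variable `U(c) = U([Lc₋, Lc₊])`,
`r_σ c = ⟨r_σc₋, r_σc₋ + e_{σμ}⟩` (elementary API). -/
theorem Ustr_permE (σ : Equiv.Perm (Fin d)) (U : ZdEdge d → G) (c : ZdEdge d) :
    Ustr L (permE σ U) c = Ustr L U (permSite σ c.1, σ c.2) := by
  unfold Ustr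
  rw [lineR_permE, permSite_blockBase]

/-- [cite: Balaban1987RG1, (2.17) p.269] plaquette variables are permutation covariant:
`(r_σU)(∂p_{x;ij}) = U(∂p_{r_σx; σi σj})`. -/
theorem plaquetteHolonomyZd_permE (σ : Equiv.Perm (Fin d)) (U : ZdEdge d → G) (x : Fin d → ℤ) (i j : Fin d) :
    plaquetteHolonomyZd (permE σ U) x i j = plaquetteHolonomyZd U (permSite σ x) (σ i) (σ j) := by
  simp only [plaquetteHolonomyZd, permE_apply, permSite_add, permSite_single]

end Blocks

/-! ## § 4  The averaged contour variables (0.11) under the relabelling of the axes -/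

section Mean

variable {𝔸 : Type*} [NormedRing 𝔸] [NormedAlgebra ℂ 𝔸] [NormOneClass 𝔸] [CompleteSpace 𝔸] {L : ℕ}

omit [NormedAlgebra ℂ 𝔸] [CompleteSpace 𝔸] in
/-- [cite: Balaban1987RG1, (0.7) p.253][cite: Balaban1987RG1, p.252] the family `{U(Γ^π_{q,x})}_π` of an
`ε₀`-regular `U1`-valued configuration has PAIRWISE relative diameter `≤ 2(dL)²ε₀` («sets … with sufficiently small
diameters»; each member is `(dL)²ε₀`-close to the tree contour by `B12ContourAverage253.rel_permT_small`). -/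
theorem rel_permT_pair_small (hL : 0 < L) (U : ZdEdge d → 𝔸ˣ) (hU : ∀ b, ‖((U b : 𝔸ˣ) : 𝔸)‖ ≤ 1)
    (hU' : ∀ b, ‖(((U b)⁻¹ : 𝔸ˣ) : 𝔸)‖ ≤ 1) {ε₀ : ℝ} (hε₀ : 0 ≤ ε₀) {y x : Fin d → ℤ} (hx : x ∈ blockSites L y)
    (hP : ∀ (p : Fin d → ℤ) (i j : Fin d), i ≠ j → blockBase L y ≤ p →
      p + Pi.single i 1 + Pi.single j 1 ≤ blockBase L y + (fun _ => (L : ℤ) - 1) →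
      ‖((plaquetteHolonomyZd U p i j : 𝔸ˣ) : 𝔸) - 1‖ ≤ ε₀)
    (i k : Equiv.Perm (Fin d)) :
    ‖rel (fun π : Equiv.Perm (Fin d) => permT L U π x) k i - 1‖ ≤ 2 * (((d : ℝ) * L) ^ 2 * ε₀) := by
  have hT : gammaT L U x ∈ U1 𝔸 := by rw [← permT_one hL]; exact permT_mem_U1 U hU hU' 1 x
  have hi := rel_permT_small hL U hU hU' hε₀ hx hP i
  have hk := rel_permT_small hL U hU hU' hε₀ hx hP k
  simp only [rel, permT_one hL, ← Units.val_mul] at hi hk ⊢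
  have hiU : permT L U i x * (gammaT L U x)⁻¹ ∈ U1 𝔸 :=
    (U1 𝔸).mul_mem (permT_mem_U1 U hU hU' i x) ((U1 𝔸).inv_mem hT)
  have hkU : permT L U k x * (gammaT L U x)⁻¹ ∈ U1 𝔸 :=
    (U1 𝔸).mul_mem (permT_mem_U1 U hU hU' k x) ((U1 𝔸).inv_mem hT)
  have hid : permT L U i x * (permT L U k x)⁻¹ =
      (permT L U i x * (gammaT L U x)⁻¹) * (permT L U k x * (gammaT L U x)⁻¹)⁻¹ := by group
  rw [hid, Units.val_mul]
  calc _ ≤ ‖((permT L U i x * (gammaT L U x)⁻¹ : 𝔸ˣ) : 𝔸) - 1‖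
          + ‖(((permT L U k x * (gammaT L U x)⁻¹)⁻¹ : 𝔸ˣ) : 𝔸) - 1‖ :=
        norm_mul_sub_one_le_of_norm_le_one (mem_U1.mp hiU).1
    _ ≤ ((d : ℝ) * L) ^ 2 * ε₀ + ((d : ℝ) * L) ^ 2 * ε₀ := add_le_add hi ((norm_inv_sub_one_le hkU).trans hk)
    _ = 2 * (((d : ℝ) * L) ^ 2 * ε₀) := by ring

omit [NormedAlgebra ℂ 𝔸] [NormOneClass 𝔸] [CompleteSpace 𝔸] in
/-- [cite: Balaban1987RG1, (0.11) p.253][cite: Balaban1987RG1, (2.17) p.269] the (0.11) family of the pulled-back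
configuration at `x` is the (0.11) family of `U` at `r_σx`, RE-INDEXED by left multiplication with `σ`
(elementary API; unconditional). -/
theorem family_permE (σ : Equiv.Perm (Fin d)) (U : ZdEdge d → 𝔸ˣ) (x : Fin d → ℤ) :
    (fun π : Equiv.Perm (Fin d) => permT L (permE σ U) π x)
      = (fun π : Equiv.Perm (Fin d) => permT L U π (permSite σ x)) ∘ (Equiv.mulLeft σ) := by
  funext π
  rw [Function.comp_apply, Equiv.coe_mulLeft, permT_permE]

/-- [cite: Balaban1987RG1, (0.11) p.253][cite: Balaban1987RG1, (0.7) p.253][cite: Balaban1987RG1, (2.17) p.269]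
**THE AVERAGED CONTOUR VARIABLES (0.11) ARE COVARIANT UNDER AXIS PERMUTATIONS**: `𝐔_{r_σU}(q, x) = 𝐔_U(r_σq, r_σx)`
for every `U1`-valued configuration whose plaquettes are `ε₀`-regular with `2(dL)²ε₀ ≤ 1/100`.  The relabelling
carries the family `{U(Γ)}_{Γ∈𝐆(q,x)}` onto `{U(Γ)}_{Γ∈𝐆(r_σq,r_σx)}` as a SET but moves the base contour of the
lineage's mean from `π = 1` to `π = σ`; by (0.7) (base-point independence, `Tavg_eq_fedAvg`) the mean is unchanged. -/
theorem Tavg_permE (hL : 0 < L) (σ : Equiv.Perm (Fin d)) (U : ZdEdge d → 𝔸ˣ) (hU1 : ∀ b, U b ∈ U1 𝔸) {ε₀ : ℝ}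
    (hε₀ : 0 ≤ ε₀) (hsm : 2 * (((d : ℝ) * L) ^ 2 * ε₀) ≤ 1 / 100)
    (hreg : ∀ (p : Fin d → ℤ) (i j : Fin d), i ≠ j → ‖((plaquetteHolonomyZd U p i j : 𝔸ˣ) : 𝔸) - 1‖ ≤ ε₀)
    (x : Fin d → ℤ) :
    Tavg L (permE σ U) x = Tavg L U (permSite σ x) := by
  haveI : NeZero L := ⟨hL.ne'⟩
  have hU : ∀ b, ‖((U b : 𝔸ˣ) : 𝔸)‖ ≤ 1 := fun b => (mem_U1.mp (hU1 b)).1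
  have hU' : ∀ b, ‖(((U b)⁻¹ : 𝔸ˣ) : 𝔸)‖ ≤ 1 := fun b => (mem_U1.mp (hU1 b)).2
  set x' : Fin d → ℤ := permSite σ x with hx'
  have hx : x' ∈ blockSites L (blockMap L x') := (mem_blockSites_iff L _ _).2 rfl
  have hP : ∀ (p : Fin d → ℤ) (i j : Fin d), i ≠ j → blockBase L (blockMap L x') ≤ p →
      p + Pi.single i 1 + Pi.single j 1 ≤ blockBase L (blockMap L x') + (fun _ => (L : ℤ) - 1) →
      ‖((plaquetteHolonomyZd U p i j : 𝔸ˣ) : 𝔸) - 1‖ ≤ ε₀ := fun p i j hij _ _ => hreg p i j hij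
  set F : Equiv.Perm (Fin d) → 𝔸ˣ := fun π => permT L U π x' with hF
  have hpair : ∀ i k, ‖rel F k i - 1‖ ≤ 2 * (((d : ℝ) * L) ^ 2 * ε₀) :=
    fun i k => rel_permT_pair_small hL U hU hU' hε₀ hx hP i k
  have h1 : Tavg L (permE σ U) x = fedAvg (F ∘ (Equiv.mulLeft σ)) 1 := by
    unfold Tavg
    rw [family_permE]
  have h2 : fedAvg (F ∘ (Equiv.mulLeft σ)) 1 = fedAvg F (Equiv.mulLeft σ 1) :=
    fedAvg_comp_equiv F (Equiv.mulLeft σ) 1 fun j => (hpair j _).trans hsm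
  have h3 : Tavg L U x' = fedAvg F σ := Tavg_eq_fedAvg hL U hU hU' hε₀ hsm hx hP σ
  rw [h1, h2, h3]
  show fedAvg F (σ * 1) = fedAvg F σ
  rw [mul_one]

omit [NormedAlgebra ℂ 𝔸] [NormOneClass 𝔸] [CompleteSpace 𝔸] in
/-- [cite: Balaban1985Averaging, (52) p.26][cite: Balaban1987RG1, (2.17) p.269] the regularity functional
`sup_p ‖U(∂p) − 1‖` is invariant under axis permutations: `sup_p ‖(r_σU)(∂p) − 1‖ = sup_p ‖U(∂p) − 1‖`
(the plaquettes are permuted among themselves; unconditional). -/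
theorem pdevZ_permE (σ : Equiv.Perm (Fin d)) (U : ZdEdge d → 𝔸ˣ) : pdevZ (permE σ U) = pdevZ U := by
  rw [pdevZ, pdevZ]
  simp only [plaquetteHolonomyZd_permE]
  exact Equiv.iSup_congr (Equiv.prodCongr (permSiteEquiv σ) (Equiv.prodCongr σ σ)) fun _ => rfl

omit [NormedAlgebra ℂ 𝔸] [CompleteSpace 𝔸] in
/-- [cite: Balaban1987RG1, (2.17) p.269] `r_σU` is `U1`-valued iff `U` is (elementary API). -/
theorem permE_mem_U1 (σ : Equiv.Perm (Fin d)) {U : ZdEdge d → 𝔸ˣ} (hU1 : ∀ b, U b ∈ U1 𝔸) (b : ZdEdge d) :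
    permE σ U b ∈ U1 𝔸 := hU1 _

omit [NormedAlgebra ℂ 𝔸] [NormOneClass 𝔸] [CompleteSpace 𝔸] in
/-- [cite: Balaban1987RG1, (2.17) p.269] `ε₀`-regularity of all plaquettes is permutation invariant (elementary
API). -/
theorem permE_regular (σ : Equiv.Perm (Fin d)) {U : ZdEdge d → 𝔸ˣ} {ε₀ : ℝ}
    (hreg : ∀ (p : Fin d → ℤ) (i j : Fin d), i ≠ j → ‖((plaquetteHolonomyZd U p i j : 𝔸ˣ) : 𝔸) - 1‖ ≤ ε₀)
    (p : Fin d → ℤ) (i j : Fin d) (hij : i ≠ j) :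
    ‖((plaquetteHolonomyZd (permE σ U) p i j : 𝔸ˣ) : 𝔸) - 1‖ ≤ ε₀ := by
  rw [plaquetteHolonomyZd_permE]
  exact hreg _ _ _ fun h => hij (σ.injective h)

/-! ## § 5  The average (0.12) under the relabelling of the axes -/

/-- [cite: Balaban1987RG1, (0.12) p.254][cite: Balaban1987RG1, (2.17) p.269] the (0.12) loops are permutation
covariant on regular configurations: `W_x(r_σU; c) = W_{r_σx}(U; r_σc)`. -/
theorem loopW_Tavg_permE (hL : 0 < L) (σ : Equiv.Perm (Fin d)) (U : ZdEdge d → 𝔸ˣ) (hU1 : ∀ b, U b ∈ U1 𝔸)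
    {ε₀ : ℝ} (hε₀ : 0 ≤ ε₀) (hsm : 2 * (((d : ℝ) * L) ^ 2 * ε₀) ≤ 1 / 100)
    (hreg : ∀ (p : Fin d → ℤ) (i j : Fin d), i ≠ j → ‖((plaquetteHolonomyZd U p i j : 𝔸ˣ) : 𝔸) - 1‖ ≤ ε₀)
    (c : ZdEdge d) (x : Fin d → ℤ) :
    loopW L (fun U : ZdEdge d → 𝔸ˣ => Tavg L U) (permE σ U) c x
      = loopW L (fun U : ZdEdge d → 𝔸ˣ => Tavg L U) U (permSite σ c.1, σ c.2) (permSite σ x) := by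
  rw [loopW_def, loopW_def, Tavg_permE hL σ U hU1 hε₀ hsm hreg, Tavg_permE hL σ U hU1 hε₀ hsm hreg, lineR_permE,
    Ustr_permE, permSite_add, permSite_single]

/-- [cite: Balaban1987RG1, (0.12) p.254][cite: Balaban1987RG1, (2.17) p.269][cite: Balaban1985Averaging, (11) p.19]
**THE AVERAGE (0.12) OVER THE AVERAGED CONTOUR VARIABLES (0.11) IS COVARIANT UNDER AXIS PERMUTATIONS**:
`\overline{r_σU} = r_σŪ` for every `U1`-valued configuration with `ε₀`-regular plaquettes, `2(dL)²ε₀ ≤ 1/100` — the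
axis-permutation case of [I] p. 254 «properties similar to the properties of the average introduced in (0.4)» /
p. 263 «invariant with respect to the Euclidean transformations of the lattice T^{(j+1)}» (print's sentence about
the explicitly defined expressions of the j-th term; here for [I]'s ACTUAL average at one level); the reflection
case fails for the corner-based lineage (module docstring (a)). -/
theorem avgBar_permE (hL : 0 < L) (σ : Equiv.Perm (Fin d)) (U : ZdEdge d → 𝔸ˣ) (hU1 : ∀ b, U b ∈ U1 𝔸)
    {ε₀ : ℝ} (hε₀ : 0 ≤ ε₀) (hsm : 2 * (((d : ℝ) * L) ^ 2 * ε₀) ≤ 1 / 100)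
    (hreg : ∀ (p : Fin d → ℤ) (i j : Fin d), i ≠ j → ‖((plaquetteHolonomyZd U p i j : 𝔸ˣ) : 𝔸) - 1‖ ≤ ε₀) :
    avgBar L (permE σ U) = permE σ (avgBar L U) := by
  funext c
  rw [permE_apply]
  unfold avgBar avgM
  dsimp only
  rw [Ustr_permE, sum_blockSites_permSite hL]
  simp only [loopW_Tavg_permE hL σ U hU1 hε₀ hsm hreg]

/-! ## § 6  The `k`-fold average under the relabelling of the axes -/

/-- [cite: Balaban1987RG1, (0.12) p.254][cite: Balaban1985Averaging, (43) p.24][cite: Balaban1987RG1, (2.17) p.269]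
**THE `k`-FOLD (0.12)/(0.11) AVERAGE IS COVARIANT UNDER AXIS PERMUTATIONS**, `\overline{r_σU}^k = r_σŪ^k`, provided
every intermediate average `Ū^j`, `j < k`, is `U1`-valued with `ε`-regular plaquettes, `2(dL)²ε ≤ 1/100` (the
regularity of the levels is an input here; `avgIter012_permE_of_unitary` discharges it from [12] Prop. 2). -/
theorem avgIter012_permE (hL : 0 < L) (σ : Equiv.Perm (Fin d)) {ε : ℝ} (hε : 0 ≤ ε)
    (hsm : 2 * (((d : ℝ) * L) ^ 2 * ε) ≤ 1 / 100) :
    ∀ (k : ℕ) (U : ZdEdge d → 𝔸ˣ), (∀ j < k, ∀ b, avgIter012 L U j b ∈ U1 𝔸) →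
      (∀ j < k, ∀ (p : Fin d → ℤ) (i i' : Fin d), i ≠ i' →
        ‖((plaquetteHolonomyZd (avgIter012 L U j) p i i' : 𝔸ˣ) : 𝔸) - 1‖ ≤ ε) →
      avgIter012 L (permE σ U) k = permE σ (avgIter012 L U k)
  | 0, U, _, _ => by simp [avgIter012_zero]
  | k + 1, U, hU1, hreg => by
      have ih := avgIter012_permE hL σ hε hsm k U (fun j hj => hU1 j (Nat.lt_succ_of_lt hj))
        (fun j hj => hreg j (Nat.lt_succ_of_lt hj))
      rw [avgIter012_succ, avgIter012_succ, ih]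
      exact avgBar_permE hL σ _ (hU1 k (Nat.lt_succ_self k)) hε hsm (hreg k (Nat.lt_succ_self k))

/-! ## § 7  The small field region of p. 255 under the relabelling of the axes -/

/-- [cite: Balaban1987RG1, p.255][cite: Balaban1987RG1, (2.17) p.269] **THE SMALL FIELD REGION IS CARRIED TO THE
SMALL FIELD REGION** («By their definitions the expressions in (2.1) are invariant with respect to these
transformations», p. 269, for the axis permutations): if a `U1`-valued `U` lies in the p. 255 region attached to the
coarse configuration `V` (regular plaquettes, the (0.16) restrictions on the averaged contour variables, `|Ū − V| ≤ ε₀`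
on coarse bonds; `B12SmallFieldRegion255.smallFieldRegion`, `2(dL)²ε₀ ≤ 1/100`), then `r_σU` lies in the region
attached to `r_σV`. -/
theorem permE_mem_smallFieldRegion (hL : 0 < L) (σ : Equiv.Perm (Fin d)) {ε₀ : ℝ} (hε₀ : 0 ≤ ε₀)
    (hsm : 2 * (((d : ℝ) * L) ^ 2 * ε₀) ≤ 1 / 100) {V U : ZdEdge d → 𝔸ˣ} (hU1 : ∀ b, U b ∈ U1 𝔸)
    (hU : U ∈ B12SmallFieldRegion255.smallFieldRegion L ε₀ V) :
    permE σ U ∈ B12SmallFieldRegion255.smallFieldRegion L ε₀ (permE σ V) := by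
  haveI : NeZero L := ⟨hL.ne'⟩
  obtain ⟨ha, hb, hc⟩ := (B12SmallFieldRegion255.mem_smallFieldRegion_iff).1 hU
  refine (B12SmallFieldRegion255.mem_smallFieldRegion_iff).2 ⟨permE_regular σ ha, ?_, ?_⟩
  · intro y x hx hne
    rw [Tavg_permE hL σ U hU1 hε₀ hsm ha]
    refine hb (permSite σ y) (permSite σ x) ((permSite_mem_blockSites_iff hL σ y x).2 hx) ?_
    rw [← permSite_blockBase]
    exact fun h => hne (permSite_injective σ h)
  · intro c
    rw [avgBar_permE hL σ U hU1 hε₀ hsm ha, permE_apply, permE_apply]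
    exact hc _

/-- [cite: Balaban1987RG1, p.255][cite: Balaban1987RG1, (2.17) p.269] … and conversely (apply the previous theorem to
`σ⁻¹`): for `U1`-valued `U`, `r_σU ∈ 𝔖(r_σV) ↔ U ∈ 𝔖(V)` — the small-field restrictions of (0.13)/(0.16)/(2.1) are
INVARIANT under the axis permutations. -/
theorem permE_mem_smallFieldRegion_iff (hL : 0 < L) (σ : Equiv.Perm (Fin d)) {ε₀ : ℝ} (hε₀ : 0 ≤ ε₀)
    (hsm : 2 * (((d : ℝ) * L) ^ 2 * ε₀) ≤ 1 / 100) {V U : ZdEdge d → 𝔸ˣ} (hU1 : ∀ b, U b ∈ U1 𝔸) :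
    permE σ U ∈ B12SmallFieldRegion255.smallFieldRegion L ε₀ (permE σ V) ↔
      U ∈ B12SmallFieldRegion255.smallFieldRegion L ε₀ V := by
  refine ⟨fun h => ?_, permE_mem_smallFieldRegion hL σ hε₀ hsm hU1⟩
  have h' := permE_mem_smallFieldRegion hL σ⁻¹ hε₀ hsm (permE_mem_U1 σ hU1) h
  rwa [← permE_mul, ← permE_mul, mul_inv_cancel, permE_one, permE_one] at h'

end Mean

section Unitary

variable {𝔸 : Type*} [CStarAlgebra 𝔸] [Nontrivial 𝔸] {L : ℕ}

/-- [cite: Balaban1987RG1, (0.12) p.254][cite: Balaban1985Averaging, Prop. 2 (54) p.26][cite: Balaban1987RG1, (2.17)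
p.269] **`\overline{r_σU}^k = r_σŪ^k` FOR REGULAR UNITARY CONFIGURATIONS**: for a unitary configuration `U` on `ℤᵈ`
(`d ≥ 1`, `L ≥ 2`, any non-trivial C⋆-algebra) with `sup_p ‖U(∂p) − 1‖ < α₀L^{−2k}`, `C₀α₀ ≤ 1/3`, `2α₀ ≤ c₂′`
(the hypotheses of [12] Prop. 2 for [I]'s average, `B12Average012Prop2.prop2_012`) and `2(dL)²(α₀ + 2C₀α₀²) ≤
1/100`, every level `Ū^j`, `j ≤ k`, is unitary and `(α₀ + 2C₀α₀²)`-regular, so the `k`-fold average is covariant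
under every axis permutation. -/
theorem avgIter012_permE_of_unitary (hL : 2 ≤ L) (hd : 1 ≤ d) (σ : Equiv.Perm (Fin d)) (k : ℕ)
    (U : ZdEdge d → 𝔸ˣ) (hU : ∀ b, U b ∈ unitaryUnits 𝔸) {α₀ : ℝ} (hα : 0 < α₀) (hα3 : C0A d * α₀ ≤ 1 / 3)
    (hα2 : 2 * α₀ ≤ c2' d L) (h52 : pdevZ U < α₀ * (((L : ℝ) ^ k)⁻¹) ^ 2)
    (hsm : 2 * (((d : ℝ) * L) ^ 2 * (α₀ + 2 * C0A d * α₀ ^ 2)) ≤ 1 / 100) :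
    avgIter012 L (permE σ U) k = permE σ (avgIter012 L U k) := by
  have hL0 : 0 < L := lt_of_lt_of_le (by norm_num) hL
  have hε : 0 ≤ α₀ + 2 * C0A d * α₀ ^ 2 := by
    have := C0A_pos d
    positivity
  -- every level `j ≤ k` satisfies the hypothesis of Prop. 2 (the window only shrinks with `j`)
  have h52j : ∀ j ≤ k, pdevZ U < α₀ * (((L : ℝ) ^ j)⁻¹) ^ 2 := by
    intro j hj
    refine lt_of_lt_of_le h52 (mul_le_mul_of_nonneg_left ?_ hα.le)
    have hL1 : (1 : ℝ) ≤ L := by exact_mod_cast le_trans (by norm_num) hL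
    have hpow : (L : ℝ) ^ j ≤ (L : ℝ) ^ k := pow_le_pow_right₀ hL1 hj
    have hjpos : 0 < (L : ℝ) ^ j := by positivity
    gcongr
  have hunit : ∀ j ≤ k, ∀ b, avgIter012 L U j b ∈ unitaryUnits 𝔸 := (prop2_012 hL hd k U hU hα hα3 hα2 h52).2
  refine avgIter012_permE hL0 σ hε hsm k U (fun j hj b => unitaryUnits_le_U1 (hunit j hj.le b)) ?_
  intro j hj p i i' _
  have hreg := (prop2_012 hL hd j U hU hα hα3 hα2 (h52j j hj.le)).1
  exact (le_pdevZ (fun b => unitaryUnits_le_U1 (hunit j hj.le b)) p i i').trans hreg.le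

end Unitary

/-! ## § 8 (v1.1)  Print's `r` is a symmetry of the TORUS `T`: periods are carried to periods, `r_σ` descends to
`(ℤ/N)ᵈ`, and `\overline{r_σU}^k = r_σŪ^k` descends to the tori `T^{(k)}` of (0.1) -/

section Torus

open B12Average012Periodicity (shiftE avgIter012_descend)
open B7AvgPeriodicity (proj torusLift descend proj_torusLift)

variable {β : Type*}

/-- [cite: Balaban1987RG1, (2.17) p.269][cite: Balaban1987RG1, (0.1) p.251] translations past axis permutations:
`τ_v ∘ r_σ = r_σ ∘ τ_{r_σ v}` on bond configurations (elementary API; the translations are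
`B12Average012Periodicity.shiftE`). -/
theorem shiftE_permE (σ : Equiv.Perm (Fin d)) (v : Fin d → ℤ) (U : ZdEdge d → β) :
    shiftE v (permE σ U) = permE σ (shiftE (permSite σ v) U) := by
  funext b
  show U (permSite σ (b.1 + v), σ b.2) = U (permSite σ b.1 + permSite σ v, σ b.2)
  rw [permSite_add]

/-- [cite: Balaban1987RG1, (2.17) p.269][cite: Balaban1987RG1, (0.1) p.251] a translation by `c·e_i` of `r_σU` is
`r_σ` of the translation of `U` by `c·e_{σ i}` — the coordinate direction is relabelled (elementary API). -/
theorem shiftE_smul_e_permE (σ : Equiv.Perm (Fin d)) (c : ℤ) (i : Fin d) (U : ZdEdge d → β) :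
    shiftE (c • e i) (permE σ U) = permE σ (shiftE (c • e (σ i)) U) := by
  rw [shiftE_permE, permSite_smul, permSite_e]

/-- [cite: Balaban1987RG1, (2.17) p.269][cite: Balaban1987RG1, (0.1) p.251] **`r_σ` PRESERVES THE TORUS**: a
configuration with period `c` in every coordinate direction (a configuration on the torus of (0.1) with equal sides)
is carried to one with the same periods. -/
theorem permE_periodic (σ : Equiv.Perm (Fin d)) {c : ℤ} {U : ZdEdge d → β}
    (hU : ∀ i : Fin d, shiftE (c • e i) U = U) (i : Fin d) : shiftE (c • e i) (permE σ U) = permE σ U := by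
  rw [shiftE_smul_e_permE, hU (σ i)]

/-- [cite: Balaban1987RG1, (2.17) p.269][cite: Balaban1987RG1, (0.1) p.251] `r_σ` on the discrete torus
`(ℤ/N)ᵈ`: the projection `ℤᵈ → (ℤ/N)ᵈ` intertwines `r_σ` with the relabelling of the torus coordinates
(elementary API; `B7AvgPeriodicity.proj`). -/
theorem proj_permSite (N : ℕ) [NeZero N] (σ : Equiv.Perm (Fin d)) (x : Fin d → ℤ) :
    proj N (permSite σ x) = fun ν => proj N x (σ.symm ν) := rfl

/-- [cite: Balaban1987RG1, (2.17) p.269][cite: Balaban1987RG1, (0.1) p.251] … and so does the section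
`(ℤ/N)ᵈ → ℤᵈ` (elementary API; `B7AvgPeriodicity.torusLift`). -/
theorem permSite_torusLift (N : ℕ) [NeZero N] (σ : Equiv.Perm (Fin d)) (w : Fin d → ZMod N) :
    permSite σ (torusLift N w) = torusLift N (fun ν => w (σ.symm ν)) := rfl

variable {𝔸 : Type*} [NormedRing 𝔸] [NormedAlgebra ℂ 𝔸] [NormOneClass 𝔸] [CompleteSpace 𝔸] {L : ℕ}

/-- [cite: Balaban1987RG1, (2.17) p.269][cite: Balaban1987RG1, (0.1) p.251][cite: Balaban1987RG1, (0.12) p.254]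
**(2.17) FOR THE `k`-FOLD (0.12)/(0.11) AVERAGE ON THE TORUS `T^{(k)}`**: for an `L^kN`-periodic configuration `U`
on `ℤᵈ` — a configuration on the torus `T` of (0.1) with `L^kN` sites a side — whose levels `Ū^j`, `j < k`, are
`U1`-valued with `ε`-regular plaquettes (`2(dL)²ε ≤ 1/100`), `r_σU` is again `L^kN`-periodic and the averages,
as configurations on the discrete torus `(ℤ/N)ᵈ = T^{(k)}` (`B7AvgPeriodicity.descend`,
`B12Average012Periodicity.avgIter012_descend`), satisfy `(\overline{r_σU}^k)^♭(w, μ) = (Ū^k)^♭(r_σ w, σμ)` at EVERY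
torus site `w` — print's «r is such a transformation [of the lattice T] preserving the lattice T^{(k+1)}» for the
axis permutations. -/
theorem avgIter012_permE_descend (hL : 0 < L) (σ : Equiv.Perm (Fin d)) {ε : ℝ} (hε : 0 ≤ ε)
    (hsm : 2 * (((d : ℝ) * L) ^ 2 * ε) ≤ 1 / 100) (k : ℕ) {N : ℕ} [NeZero N] (U : ZdEdge d → 𝔸ˣ)
    (hU : ∀ i : Fin d, shiftE ((((L : ℤ) ^ k) * (N : ℤ)) • e i) U = U)
    (hU1 : ∀ j < k, ∀ b, avgIter012 L U j b ∈ U1 𝔸)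
    (hreg : ∀ j < k, ∀ (p : Fin d → ℤ) (i i' : Fin d), i ≠ i' →
      ‖((plaquetteHolonomyZd (avgIter012 L U j) p i i' : 𝔸ˣ) : 𝔸) - 1‖ ≤ ε)
    (w : Fin d → ZMod N) (μ : Fin d) :
    descend N (Function.curry (avgIter012 L (permE σ U) k)) w μ
      = descend N (Function.curry (avgIter012 L U k)) (fun ν => w (σ.symm ν)) (σ μ) := by
  obtain ⟨x, rfl⟩ : ∃ x, proj N x = w := ⟨torusLift N w, proj_torusLift N w⟩
  rw [avgIter012_descend hL k (permE_periodic σ hU) x μ, avgIter012_permE hL σ hε hsm k U hU1 hreg, permE_apply,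
    ← proj_permSite, avgIter012_descend hL k hU]

end Torus

section TorusUnitary

open B12Average012Periodicity (shiftE)
open B7AvgPeriodicity (descend)

variable {𝔸 : Type*} [CStarAlgebra 𝔸] [Nontrivial 𝔸] {L : ℕ}

/-- [cite: Balaban1987RG1, (2.17) p.269][cite: Balaban1987RG1, (0.1) p.251][cite: Balaban1985Averaging, Prop. 2 (54)
p.26] **THE SAME FOR REGULAR UNITARY CONFIGURATIONS ON THE TORUS**, the levelwise regularity discharged by [12]
Prop. 2 for [I]'s average (`avgIter012_permE_of_unitary`): for a unitary `L^kN`-periodic `U` with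
`sup_p ‖U(∂p) − 1‖ < α₀L^{−2k}`, `C₀α₀ ≤ 1/3`, `2α₀ ≤ c₂′`, `2(dL)²(α₀ + 2C₀α₀²) ≤ 1/100`, the `k`-fold averages of
`r_σU` and `U` on `T^{(k)} = (ℤ/N)ᵈ` satisfy `(\overline{r_σU}^k)^♭(w, μ) = (Ū^k)^♭(r_σ w, σμ)`. -/
theorem avgIter012_permE_descend_of_unitary (hL : 2 ≤ L) (hd : 1 ≤ d) (σ : Equiv.Perm (Fin d)) (k : ℕ)
    {N : ℕ} [NeZero N] (U : ZdEdge d → 𝔸ˣ) (hUu : ∀ b, U b ∈ unitaryUnits 𝔸)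
    (hU : ∀ i : Fin d, shiftE ((((L : ℤ) ^ k) * (N : ℤ)) • e i) U = U) {α₀ : ℝ} (hα : 0 < α₀)
    (hα3 : C0A d * α₀ ≤ 1 / 3) (hα2 : 2 * α₀ ≤ c2' d L) (h52 : pdevZ U < α₀ * (((L : ℝ) ^ k)⁻¹) ^ 2)
    (hsm : 2 * (((d : ℝ) * L) ^ 2 * (α₀ + 2 * C0A d * α₀ ^ 2)) ≤ 1 / 100) (w : Fin d → ZMod N) (μ : Fin d) :
    descend N (Function.curry (avgIter012 L (permE σ U) k)) w μ
      = descend N (Function.curry (avgIter012 L U k)) (fun ν => w (σ.symm ν)) (σ μ) := by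
  have hL0 : 0 < L := lt_of_lt_of_le (by norm_num) hL
  obtain ⟨x, rfl⟩ : ∃ x, B7AvgPeriodicity.proj N x = w :=
    ⟨B7AvgPeriodicity.torusLift N w, B7AvgPeriodicity.proj_torusLift N w⟩
  rw [B12Average012Periodicity.avgIter012_descend hL0 k (permE_periodic σ hU) x μ,
    avgIter012_permE_of_unitary hL hd σ k U hUu hα hα3 hα2 h52 hsm, permE_apply, ← proj_permSite,
    B12Average012Periodicity.avgIter012_descend hL0 k hU]

end TorusUnitary

end Literature.MathematicalPhysics.QuantumFieldTheory.Balaban1983to89.B12Average012Permutation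

end
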